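import Summits.KontsevichZagierPeriods.KontsevichZagierPeriods.Theorems.HurwitzMicroSectorsNormalFormPrincipleLevelOne
import Summits.KontsevichZagierPeriods.KontsevichZagierPeriods.Theorems.HurwitzMicroSectorsNormalFormPrincipleSlabASubPtK20
import Summits.KontsevichZagierPeriods.KontsevichZagierPeriods.Theorems.HurwitzMicroSectorsNormalFormPrincipleAlgCarriers
import Summits.KontsevichZagierPeriods.KontsevichZagierPeriods.Theorems.HurwitzMicroSectorsNormalFormPrincipleM2FiveZetaTwo

/-!
# `NormalFormPrinciple` (stmt-KontsevichZagierPeriods-3869), line `SketchIdeator1` — leaf `stub_boxRigidity`: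
# weight two, level `K`, off the diagonal: the dimension-one end of the pipeline has KZ's rational shape

Pure proof file (`--supports` the crux). The level-`K` pipeline for the boxes
`[(0,1)², c x^a y^b/(1 − x^K y^K)]`, `a ≠ b`, ends (after the merge `u = xy`, rule 2, and integrating
out `x`, rule 3) at the dimension-one representation `[(0,1), (c/(a−b)) (u^b − u^a)/(1 − u^K)]`.
For `c ∈ ℚ` this representation has KZ's literal rational shape `KZ.IntegralRep.IsRational`:
its integrand agrees on `(0,1)` with `p/q` for the `ℚ`-polynomials
`p = C (c/(a−b)) · (X₀^b − X₀^a)` and `q = 1 − X₀^K`, and `q = 1 − u^K > 0` on `(0,1)` since `K ≥ 1`.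
(The constant `c/(a−b)` is read with the truncated natural subtraction `a − b : ℕ`, exactly as in the
pipeline's statement.) Hence the whole layer lands in the dimension-`≤ 1` rational layer.

References: M. Kontsevich, D. Zagier, *Periods* (2001), §1.1 Definition, §1.2.
No new definitions.
-/

noncomputable section

open MeasureTheory Set
open Literature.NumberTheory.Transcendental Literature.NumberTheory.Transcendental.KZ
open Literature.ModelTheory.ExponentialFields (IsSemialgebraic)

namespace Summit.KontsevichZagierPeriods.HurwitzMicroSectors.NormalFormPrinciple.PiBox.LevelK

/-- **Stub K4 (the dimension-one end of the level-`K` pipeline has KZ's rational shape).**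
A representation of dimension one on `(0,1)` whose integrand agrees there with
`(c/(a−b)) (u^b − u^a)/(1 − u^K)`, `c ∈ ℚ`, `K ≥ 1`, is `IsRational`: take
`p = C (c/(a−b)) (X₀^b − X₀^a)`, `q = 1 − X₀^K ∈ ℚ[X₀]`; `q ≠ 0` on `(0,1)` because `u^K < 1` there.
[cite: KontsevichZagier2001, §1.1 Definition] -/
theorem levelK_dimOne_isRational (K : ℕ) (hK : 0 < K) (a b : ℕ) (c : ℚ) (N₁ : IntegralRep 1)
    (hN₁d : N₁.domain = {x | ∀ i, x i ∈ Set.Ioo (0:ℝ) 1})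
    (hN₁i : EqOn N₁.integrand
      (fun x => (c : ℝ) / ((a - b : ℕ) : ℝ) * (x 0 ^ b - x 0 ^ a) / (1 - x 0 ^ K)) N₁.domain) :
    N₁.IsRational := by
  refine ⟨MvPolynomial.C (c / ((a - b : ℕ) : ℚ)) * (MvPolynomial.X 0 ^ b - MvPolynomial.X 0 ^ a),
    1 - MvPolynomial.X 0 ^ K, fun x hx => ?_, fun x hx => ?_⟩
  · have hx' : x 0 ∈ Set.Ioo (0:ℝ) 1 := by rw [hN₁d] at hx; exact hx 0
    simp only [map_sub, map_one, map_pow, MvPolynomial.aeval_X]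
    exact (sub_pos.2 (pow_lt_one₀ hx'.1.le hx'.2 hK.ne')).ne'
  · rw [hN₁i hx]
    simp only [map_sub, map_one, map_pow, map_mul, MvPolynomial.aeval_C, MvPolynomial.aeval_X,
      eq_ratCast, Rat.cast_div, Rat.cast_natCast]

end Summit.KontsevichZagierPeriods.HurwitzMicroSectors.NormalFormPrinciple.PiBox.LevelK
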